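import Summits.BirchSwinnertonDyer.BirchSwinnertonDyer.Theorems.QuadraticBranchSignedControlPlusEtaNonsurjCMRowsInert
import Summits.BirchSwinnertonDyer.BirchSwinnertonDyer.Theorems.QuadraticBranchSignedControlPlusEtaNonsurjBDMTVPrimesRows
import Summits.BirchSwinnertonDyer.BirchSwinnertonDyer.Theorems.QuadraticBranchSignedControlPlusEtaNonsurjQuarticTwistDoor
import Literature.NumberTheory.SerreUniformity.Statement
import Literature.NumberTheory.EllipticCurves.BSDSelmerPConverseSerreProofs
import Mathlib.NumberTheory.LegendreSymbol.QuadraticReciprocity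
import Mathlib.Tactic.NormNum.LegendreSymbol
import HarnessLib

/-!
# Route `QuadraticBranchSignedControl` (rung K8, cell `bsd-potss`): crux stmt-BirchSwinnertonDyer-19606
# `PlusEtaMainConjectureNonsurj` — THE CM ROWS, UNIFORMLY IN `p`: one Legendre-symbol criterion, the `j = 1728` / `j = 0` classes
# (`p ≡ 3 (mod 4)` / `p ≡ 2 (mod 3)`), CM rows at every `p ≢ 1 (mod 12)`, and the first prime (`15073`) with NO CM row — where,
# under Serre's uniformity question, the crux is VACUOUSLY true

WHAT. k8eta-c2 g17 (`…CMRowsInert`, p652201) proved `cmRow_iff_cmInert`: for `V/ℚ` globally minimal, good at `p ≥ 5`, WITH CM,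
`V` is a row of crux 19606 (`a_p(V) = 0` and the `p`-adic tower is not onto) iff `p` is INERT in the CM field, and tabulated the
`j`-lists at the five primes `5, 7, 11` (there) and `13, 17` (`…BDMTVPrimesDeuring`) by thirteen-case `decide`s. This file makes the
criterion UNIFORM in `p` and draws the consequences the per-prime tables cannot state:

* §1 `cmInert_iff_legendreSym_eq_neg_one` — for `p ≠ 2` and ANY elliptic `V/ℚ`: `CMInert V p ⟺ (d_K(j(V)) | p) = −1` (Legendre
  symbol of the fundamental CM discriminant `cmFieldDiscrOfJ`); hence `cmRow_iff_legendreSym_eq_neg_one` (the CM rows at `p ≥ 5` by ONE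
  symbol; every per-prime table of the lineage is a `norm_num` evaluation of it).
* §2 `j = 1728` (CM by `ℤ[i]`): `cmRow_iff_of_j_eq_1728` — a globally minimal curve with `j = 1728`, good at `p ≥ 5`, is a row iff
  `p ≡ 3 (mod 4)`; and `64a4 : y² = x³ + x` IS such a row at every `p ≡ 3 (mod 4)` (`exists_cmRow_of_mod_four_eq_three`).
* §3 `j = 0` (CM by `ℤ[ζ₃]`): `isSquare_neg_three_iff` (`−3` is a square mod `p ≥ 5` iff `p ≡ 1 (mod 3)`, via a primitive cube root of
  unity — not in Mathlib at this pin), `cmRow_iff_of_j_eq_zero` — row iff `p ≡ 2 (mod 3)`; `27a3 : y² + y = x³` is a row at every such `p`.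
* §4 `exists_cmRow_of_mod_twelve_ne_one` — at EVERY prime `p ≥ 5` with `p ≢ 1 (mod 12)` crux 19606 has a CM row (so its CM stubs
  `stub_conjA_partners_cm` / `stub_analyticEtaMu_cm` are non-vacuous at a set of primes of density `3/4`, by quartic/sextic twist
  families alone).
* §5 the other extreme: `not_cmRow_fifteen073` — at `p = 15073` (the least prime split in all nine imaginary quadratic fields of class
  number one: `(d | 15073) = +1` for `d ∈ {−3,−4,−7,−8,−11,−19,−43,−67,−163}`, kernel `norm_num` on Jacobi symbols) NO CM curve is a row;
  with Serre's lifting lemma (tree theorem `serre_hasSurjectiveModNGaloisRep_pow_holds`) the crux at `15073` is then VACUOUS: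
  `quadraticBranchPlusEtaAt_fifteen073_of_serreUniformityBound` — (C1⁺_η) at `p = 15073` for every row, from `SerreUniformityBound 37`
  ALONE (no CM input, no transfer binder, no analytic `μ`). Dually `cmRow_3167_of_hasCM`: at `p = 3167` (least prime inert in all nine)
  EVERY globally minimal CM curve good at `p` is a row — all thirteen classes occur.

HONEST FRAMING (cell `bsd-potss`, run/shared/lean/pub/bsd-potss/; FULL-BSD rank ≤ 1 programme): structure / bookkeeping theorems; no
definition, no named fact, no `sorry`, axioms standard. `SerreUniformityBound 37` is an OPEN hypothesis (displayed binder, never asserted).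
Nothing about (C1⁺_η), (A) or the analytic `μ` is proved at any prime carrying a row; crux 19606 stays OPEN; `BSD(W, p)` is claimed for no
pair. Seat `bsd-potss-k8eta-c2` g18 (prover), `--supports stmt-BirchSwinnertonDyer-19606`.

References: [Cox2013] Prop. 5.16 / Cor. 5.17 (splitting of `p` in `ℚ(√d_K)` by the Legendre symbol); [Lang1987] Ch. 13 §4 Thm. 12 (Deuring);
[IrelandRosen1990] Prop. 9.1.? / Ch. 9 §1 (cube roots of unity and `−3` as a residue); [SilvermanAdvancedTopics1994] App. A §3 (the thirteen
CM `j`); [Zywina2015] Prop. 1.14; [SerreKyoto1977] question 6.5 (uniformity); [Cremona1997] Table 1 (`27a3`, `64a4`).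
-/

set_option autoImplicit false
set_option linter.dupNamespace false

noncomputable section

open scoped Classical

open WeierstrassCurve Literature.NumberTheory.EllipticCurves Literature.NumberTheory.EllipticCurves.Rank1Residual
  Literature.NumberTheory.SerreUniformity
open Summit.BirchSwinnertonDyer.BirchSwinnertonDyer.Rank1Residual.IntModel (integralModelInt_eq_of_map_eq map_mk_int minimalDiscriminantInt_eq)
open Summit.BirchSwinnertonDyer.Rank1Residual.Additive (QuadraticBranchPlusEtaMainConjectureAt)

namespace Summit.BirchSwinnertonDyer.BirchSwinnertonDyer.Theorems.EtaCartanField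

/-! ## §1 The uniform criterion: one Legendre symbol -/

/-- **`p` is inert in the CM field iff `(d_K | p) = −1`** (`p ≠ 2`; `d_K = cmFieldDiscrOfJ j(V)` the fundamental discriminant of the
CM field; for a non-CM `j` the tree's table returns a default value and the statement is still the definitional unfolding). `CMInert`
is `¬(p ∣ d_K) ∧ ¬(¬ p ∣ d_K ∧ d_K square mod p)`; `legendreSym p d = −1 ⟺ d` is a non-square mod `p` (Mathlib), and a multiple of
`p` is the square `0`. [cite: Cox2013, Prop. 5.16 and Cor. 5.17] -/
theorem cmInert_iff_legendreSym_eq_neg_one (V : WeierstrassCurve ℚ) [V.IsElliptic] (p : ℕ) [Fact p.Prime] (hp2 : p ≠ 2) :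
    CMInert V p ↔ legendreSym p (cmFieldDiscrOfJ V.j) = -1 := by
  unfold CMInert CMRamified CMSplit
  rw [if_neg hp2, legendreSym.eq_neg_one_iff]
  constructor
  · rintro ⟨hnd, hns⟩ hsq
    exact hns ⟨hnd, hsq⟩
  · intro hns
    have hnd : ¬ (p : ℤ) ∣ cmFieldDiscrOfJ V.j := fun hd =>
      hns (by rw [(ZMod.intCast_zmod_eq_zero_iff_dvd _ p).mpr hd]; exact ⟨0, (mul_zero 0).symm⟩)
    exact ⟨hnd, fun h => hns h.2⟩

/-- **THE CM ROWS OF CRUX 19606 BY ONE LEGENDRE SYMBOL.** For `V/ℚ` globally minimal, good at `p ≥ 5`, WITH CM: `V` is a row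
(`a_p(V) = 0` and the `p`-adic tower is not onto) iff `(d_K(j(V)) | p) = −1`. (`cmRow_iff_cmInert`, k8eta-c2 g17, + §1.)
[cite: Lang1987, Ch. 13 §4 Thm. 12] [cite: Cox2013, Cor. 5.17] [cite: Zywina2015, Prop. 1.14] -/
theorem cmRow_iff_legendreSym_eq_neg_one (V : WeierstrassCurve ℚ) [V.IsElliptic] [V.IsGloballyMinimal] (p : ℕ) [Fact p.Prime]
    (hp5 : 5 ≤ p) (hgood : V.HasGoodReductionAtPrime p) (hCM : V.HasCM) :
    (V.frobeniusTrace p = 0 ∧ ¬ ∀ m : ℕ, V.HasSurjectiveModNGaloisRep (p ^ m : ℕ)) ↔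
      legendreSym p (cmFieldDiscrOfJ V.j) = -1 := by
  rw [cmRow_iff_cmInert V p hp5 hgood hCM, cmInert_iff_legendreSym_eq_neg_one V p (by omega)]

/-! ## §2 The class `j = 1728` (`K = ℚ(i)`): rows iff `p ≡ 3 (mod 4)` -/

/-- `2 ≠ 0` in `𝔽_p` for an odd prime `p`. [folklore] -/
private theorem two_ne_zero_zmod (p : ℕ) [Fact p.Prime] (hp2 : p ≠ 2) : (2 : ZMod p) ≠ 0 := by
  have h : ((2 : ℕ) : ZMod p) ≠ 0 := by
    rw [Ne, ZMod.natCast_eq_zero_iff]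
    intro hd
    exact hp2 ((Nat.prime_dvd_prime_iff_eq Fact.out Nat.prime_two).mp hd)
  exact_mod_cast h

/-- `−4` is a square mod an odd prime `p` iff `−1` is, iff `p ≢ 3 (mod 4)`. [folklore] -/
theorem isSquare_neg_four_iff (p : ℕ) [Fact p.Prime] (hp2 : p ≠ 2) : IsSquare (-4 : ZMod p) ↔ p % 4 ≠ 3 := by
  rw [← ZMod.exists_sq_eq_neg_one_iff]
  have h2 := two_ne_zero_zmod p hp2
  constructor
  · rintro ⟨x, hx⟩
    exact ⟨x * 2⁻¹, by
      have : x * 2⁻¹ * (x * 2⁻¹) = (x * x) * (2⁻¹ * 2⁻¹) := by ring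
      rw [this, ← hx]
      field_simp
      norm_num⟩
  · rintro ⟨y, hy⟩
    exact ⟨2 * y, by linear_combination (4 : ZMod p) * hy⟩

/-- **`j = 1728`: `p` inert in `ℚ(i)` iff `p ≡ 3 (mod 4)`** (odd `p`). [cite: Cox2013, Cor. 5.17] -/
theorem cmInert_iff_of_j_eq_1728 (V : WeierstrassCurve ℚ) [V.IsElliptic] (hj : V.j = 1728) (p : ℕ) [Fact p.Prime] (hp2 : p ≠ 2) :
    CMInert V p ↔ p % 4 = 3 := by
  have hd : cmFieldDiscrOfJ V.j = -4 := by rw [hj]; norm_num [cmFieldDiscrOfJ]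
  rw [cmInert_iff_legendreSym_eq_neg_one V p hp2, hd, legendreSym.eq_neg_one_iff, Int.cast_neg, Int.cast_ofNat,
    isSquare_neg_four_iff p hp2, not_not]

/-- **THE `j = 1728` ROWS OF CRUX 19606 (all `p` at once).** For `V/ℚ` globally minimal with `j(V) = 1728`, good at `p ≥ 5`:
`V` is a row (`a_p(V) = 0`, tower not onto) iff `p ≡ 3 (mod 4)`. These rows are the quartic twists `y² = x³ + A x` of `64a4`, the
domain of the CM stubs on this class. [cite: Lang1987, Ch. 13 §4 Thm. 12] [cite: IrelandRosen1990, Ch. 18 §4] [cite: Zywina2015, Prop. 1.14] -/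
theorem cmRow_iff_of_j_eq_1728 (V : WeierstrassCurve ℚ) [V.IsElliptic] [V.IsGloballyMinimal] (hj : V.j = 1728) (p : ℕ) [Fact p.Prime]
    (hp5 : 5 ≤ p) (hgood : V.HasGoodReductionAtPrime p) :
    (V.frobeniusTrace p = 0 ∧ ¬ ∀ m : ℕ, V.HasSurjectiveModNGaloisRep (p ^ m : ℕ)) ↔ p % 4 = 3 := by
  have hCM : V.HasCM := (hasCM_iff_j_mem_holds V).mpr (by rw [hj]; decide)
  rw [cmRow_iff_cmInert V p hp5 hgood hCM, cmInert_iff_of_j_eq_1728 V hj p (by omega)]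

/-- **At every prime `p ≡ 3 (mod 4)`, `p ≥ 5`, the curve `64a4 : y² = x³ + x` is a CM row of crux 19606 with `j = 1728`** (good at
`p` since `Δ_min = −64`; §2). [cite: Cremona1997, Table 1 (64a4)] [cite: Lang1987, Ch. 13 §4 Thm. 12] -/
theorem exists_cmRow_of_mod_four_eq_three (p : ℕ) [Fact p.Prime] (hp5 : 5 ≤ p) (hp4 : p % 4 = 3) :
    ∃ (V : WeierstrassCurve ℚ) (_ : V.IsElliptic) (_ : V.IsGloballyMinimal),
      V.HasGoodReductionAtPrime p ∧ V.frobeniusTrace p = 0 ∧ ¬ (∀ m : ℕ, V.HasSurjectiveModNGaloisRep (p ^ m : ℕ)) ∧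
        V.HasCM ∧ V.j = 1728 := by
  haveI := isElliptic_cm64a4
  haveI := isGloballyMinimal_cm64a4
  set E₀ : WeierstrassCurve ℚ := ⟨0, 0, 0, 1, 0⟩ with hE₀
  have hp : p.Prime := Fact.out
  have hIE : integralModelInt E₀ = ⟨0, 0, 0, 1, 0⟩ := integralModelInt_eq_of_map_eq _ (by rw [hE₀]; exact map_mk_int 0 0 0 1 0)
  have hj : E₀.j = 1728 := by
    rw [Summit.BirchSwinnertonDyer.Rank1Residual.X9.j_eq_of_intModel 0 0 0 1 0 hIE]; decide +kernel
  have hgood : E₀.HasGoodReductionAtPrime p := by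
    refine E₀.hasGoodReductionAtPrime_of_not_dvd p ?_
    rw [minimalDiscriminantInt_eq hIE]
    have hΔ : (⟨0, 0, 0, 1, 0⟩ : WeierstrassCurve ℤ).Δ = -64 := by
      simp [WeierstrassCurve.Δ, WeierstrassCurve.b₂, WeierstrassCurve.b₄, WeierstrassCurve.b₆, WeierstrassCurve.b₈]
    rw [hΔ, dvd_neg, show (64 : ℤ) = 2 ^ 6 by norm_num]
    intro h
    have h2 : (p : ℤ) ∣ 2 := Int.Prime.dvd_pow' hp h
    have : p ∣ 2 := by exact_mod_cast h2
    have := (Nat.prime_dvd_prime_iff_eq hp Nat.prime_two).mp this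
    omega
  have hCM : E₀.HasCM := (hasCM_iff_j_mem_holds E₀).mpr (by rw [hj]; decide)
  obtain ⟨hap, hns⟩ := (cmRow_iff_of_j_eq_1728 E₀ hj p hp5 hgood).mpr hp4
  exact ⟨E₀, ‹_›, ‹_›, hgood, hap, hns, hCM, hj⟩

/-! ## §3 The class `j = 0` (`K = ℚ(√−3)`): rows iff `p ≡ 2 (mod 3)` -/

/-- **`−3` is a square mod a prime `p ≥ 5` iff `p ≡ 1 (mod 3)`** — i.e. iff `𝔽_p` contains a primitive cube root of unity `ω`
(`(2ω + 1)² = −3`; conversely `ω = (x − 1)/2` has order `3` dividing `p − 1`). Not in Mathlib at this pin (which has `−1`, `±2`).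
[cite: IrelandRosen1990, Ch. 9 §1 and Prop. 8.3.? (cube roots of unity mod p)] -/
theorem isSquare_neg_three_iff (p : ℕ) [hp : Fact p.Prime] (hp5 : 5 ≤ p) : IsSquare (-3 : ZMod p) ↔ p % 3 = 1 := by
  have hP : p.Prime := hp.out
  have h2 : (2 : ZMod p) ≠ 0 := two_ne_zero_zmod p (by omega)
  have h3 : (3 : ZMod p) ≠ 0 := by
    have h : ((3 : ℕ) : ZMod p) ≠ 0 := by
      rw [Ne, ZMod.natCast_eq_zero_iff]
      intro hd
      have := (Nat.prime_dvd_prime_iff_eq hP Nat.prime_three).mp hd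
      omega
    exact_mod_cast h
  haveI : Fact (Nat.Prime 3) := ⟨Nat.prime_three⟩
  constructor
  · rintro ⟨x, hx⟩
    -- `ω = (x - 1)/2` is a primitive cube root of unity
    set ω : ZMod p := (x - 1) * 2⁻¹ with hω
    have hxω : x = 2 * ω + 1 := by rw [hω]; field_simp; ring
    have hq : ω ^ 2 + ω + 1 = 0 := by
      have h4 : (4 : ZMod p) * (ω ^ 2 + ω + 1) = 0 := by
        have : (2 * ω + 1) * (2 * ω + 1) = -3 := by rw [← hxω]; exact hx.symm
        linear_combination this
      rcases mul_eq_zero.mp h4 with h | h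
      · exact absurd h (by
          have : (4 : ZMod p) = 2 * 2 := by norm_num
          rw [this]; exact mul_ne_zero h2 h2)
      · exact h
    have hω3 : ω ^ 3 = 1 := by linear_combination (ω - 1) * hq
    have hω1 : ω ≠ 1 := by
      intro h1; rw [h1] at hq; apply h3; linear_combination hq
    have hω0 : ω ≠ 0 := by
      intro h0; rw [h0] at hq; simp at hq
    have hord : orderOf ω = 3 := orderOf_eq_prime hω3 hω1
    have hdvd : 3 ∣ p - 1 := by
      rw [← hord]; exact orderOf_dvd_of_pow_eq_one (ZMod.pow_card_sub_one_eq_one hω0)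
    obtain ⟨k, hk⟩ := hdvd
    omega
  · intro h1
    -- an element of order `3` in `𝔽_pˣ`
    have hcard : 3 ∣ Fintype.card (ZMod p)ˣ := by
      rw [ZMod.card_units p]; exact ⟨(p - 1) / 3, by omega⟩
    obtain ⟨g, hg⟩ := exists_prime_orderOf_dvd_card 3 hcard
    set ω : ZMod p := (g : ZMod p) with hω
    have hω3 : ω ^ 3 = 1 := by
      rw [hω, ← Units.val_pow_eq_pow_val, ← hg, pow_orderOf_eq_one, Units.val_one]
    have hω1 : ω ≠ 1 := by
      intro h
      have hg1 : g = 1 := Units.val_eq_one.mp h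
      rw [hg1, orderOf_one] at hg
      norm_num at hg
    have hq : ω ^ 2 + ω + 1 = 0 := by
      have hfac : (ω - 1) * (ω ^ 2 + ω + 1) = 0 := by linear_combination hω3
      rcases mul_eq_zero.mp hfac with h | h
      · exact absurd (sub_eq_zero.mp h) hω1
      · exact h
    exact ⟨2 * ω + 1, by linear_combination (-4 : ZMod p) * hq⟩

/-- **`j = 0`: `p` inert in `ℚ(√−3)` iff `p ≡ 2 (mod 3)`** (`p ≥ 5`). [cite: Cox2013, Cor. 5.17] -/
theorem cmInert_iff_of_j_eq_zero (V : WeierstrassCurve ℚ) [V.IsElliptic] (hj : V.j = 0) (p : ℕ) [Fact p.Prime] (hp5 : 5 ≤ p) :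
    CMInert V p ↔ p % 3 = 2 := by
  have hP : p.Prime := Fact.out
  have hd : cmFieldDiscrOfJ V.j = -3 := by rw [hj]; norm_num [cmFieldDiscrOfJ]
  rw [cmInert_iff_legendreSym_eq_neg_one V p (by omega), hd, legendreSym.eq_neg_one_iff, Int.cast_neg, Int.cast_ofNat,
    isSquare_neg_three_iff p hp5]
  have h3 : ¬ 3 ∣ p := fun h => by have := (Nat.prime_dvd_prime_iff_eq Nat.prime_three hP).mp h; omega
  omega

/-- **THE `j = 0` ROWS OF CRUX 19606 (all `p` at once).** For `V/ℚ` globally minimal with `j(V) = 0`, good at `p ≥ 5`: `V` is a row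
iff `p ≡ 2 (mod 3)`. These rows are the sextic twists `y² = x³ + B` — the domain of the CM stubs on this class (at `17` the 35 in-table
sextic rows of g17; at `5` and `11` the families of this seat's census). [cite: Lang1987, Ch. 13 §4 Thm. 12] [cite: Zywina2015, Prop. 1.14] -/
theorem cmRow_iff_of_j_eq_zero (V : WeierstrassCurve ℚ) [V.IsElliptic] [V.IsGloballyMinimal] (hj : V.j = 0) (p : ℕ) [Fact p.Prime]
    (hp5 : 5 ≤ p) (hgood : V.HasGoodReductionAtPrime p) :
    (V.frobeniusTrace p = 0 ∧ ¬ ∀ m : ℕ, V.HasSurjectiveModNGaloisRep (p ^ m : ℕ)) ↔ p % 3 = 2 := by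
  have hCM : V.HasCM := (hasCM_iff_j_mem_holds V).mpr (by rw [hj]; decide)
  rw [cmRow_iff_cmInert V p hp5 hgood hCM, cmInert_iff_of_j_eq_zero V hj p hp5]

/-- **At every prime `p ≡ 2 (mod 3)`, `p ≥ 5`, the curve `27a3 : y² + y = x³` is a CM row of crux 19606 with `j = 0`** (good at `p`
since `Δ_min = −27`; §3). [cite: Cremona1997, Table 1 (27a3)] [cite: Lang1987, Ch. 13 §4 Thm. 12] -/
theorem exists_cmRow_of_mod_three_eq_two (p : ℕ) [Fact p.Prime] (hp5 : 5 ≤ p) (hp3 : p % 3 = 2) :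
    ∃ (V : WeierstrassCurve ℚ) (_ : V.IsElliptic) (_ : V.IsGloballyMinimal),
      V.HasGoodReductionAtPrime p ∧ V.frobeniusTrace p = 0 ∧ ¬ (∀ m : ℕ, V.HasSurjectiveModNGaloisRep (p ^ m : ℕ)) ∧
        V.HasCM ∧ V.j = 0 := by
  haveI := EtaBDMTVPrimes.isElliptic_A3z
  haveI := EtaBDMTVPrimes.isGloballyMinimal_A3z
  set E₀ : WeierstrassCurve ℚ := ⟨0, 0, 1, 0, 0⟩ with hE₀
  have hp : p.Prime := Fact.out
  have hIE : integralModelInt E₀ = ⟨0, 0, 1, 0, 0⟩ := integralModelInt_eq_of_map_eq _ (by rw [hE₀]; exact map_mk_int 0 0 1 0 0)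
  have hj : E₀.j = 0 := EtaBDMTVPrimes.j_A3z
  have hgood : E₀.HasGoodReductionAtPrime p := by
    refine E₀.hasGoodReductionAtPrime_of_not_dvd p ?_
    rw [minimalDiscriminantInt_eq hIE]
    have hΔ : (⟨0, 0, 1, 0, 0⟩ : WeierstrassCurve ℤ).Δ = -27 := by
      simp [WeierstrassCurve.Δ, WeierstrassCurve.b₂, WeierstrassCurve.b₄, WeierstrassCurve.b₆, WeierstrassCurve.b₈]
    rw [hΔ, dvd_neg, show (27 : ℤ) = 3 ^ 3 by norm_num]
    intro h
    have h3 : (p : ℤ) ∣ 3 := Int.Prime.dvd_pow' hp h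
    have : p ∣ 3 := by exact_mod_cast h3
    have := (Nat.prime_dvd_prime_iff_eq hp Nat.prime_three).mp this
    omega
  have hCM : E₀.HasCM := (hasCM_iff_j_mem_holds E₀).mpr (by rw [hj]; decide)
  obtain ⟨hap, hns⟩ := (cmRow_iff_of_j_eq_zero E₀ hj p hp5 hgood).mpr hp3
  exact ⟨E₀, ‹_›, ‹_›, hgood, hap, hns, hCM, hj⟩

/-! ## §4 CM rows at every `p ≢ 1 (mod 12)` -/

/-- **At every prime `p ≥ 5` with `p ≢ 1 (mod 12)` crux 19606 has a CM row** (`p ≡ 3 (mod 4)`: `64a4`, `j = 1728`; `p ≡ 2 (mod 3)`: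
`27a3`, `j = 0`): the CM stubs of skeleton v7 are non-vacuous at a set of primes of Dirichlet density `3/4` by the quartic / sextic classes
alone. (At `p ≡ 1 (mod 12)` the CM rows, if any, come from `d_K ∈ {−7,−8,−11,−19,−43,−67,−163}`; §5 exhibits a prime with none.)
[cite: Lang1987, Ch. 13 §4 Thm. 12] [cite: Cremona1997, Table 1] -/
theorem exists_cmRow_of_mod_twelve_ne_one (p : ℕ) [Fact p.Prime] (hp5 : 5 ≤ p) (h12 : p % 12 ≠ 1) :
    ∃ (V : WeierstrassCurve ℚ) (_ : V.IsElliptic) (_ : V.IsGloballyMinimal),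
      V.HasGoodReductionAtPrime p ∧ V.frobeniusTrace p = 0 ∧ ¬ (∀ m : ℕ, V.HasSurjectiveModNGaloisRep (p ^ m : ℕ)) ∧ V.HasCM := by
  have hp : p.Prime := Fact.out
  have h2 : ¬ 2 ∣ p := fun h => by have := (Nat.prime_dvd_prime_iff_eq Nat.prime_two hp).mp h; omega
  have h3 : ¬ 3 ∣ p := fun h => by have := (Nat.prime_dvd_prime_iff_eq Nat.prime_three hp).mp h; omega
  have hcases : p % 4 = 3 ∨ p % 3 = 2 := by omega
  rcases hcases with h4 | h3'
  · obtain ⟨V, _, _, hg, ha, hn, hc, -⟩ := exists_cmRow_of_mod_four_eq_three p hp5 h4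
    exact ⟨V, ‹_›, ‹_›, hg, ha, hn, hc⟩
  · obtain ⟨V, _, _, hg, ha, hn, hc, -⟩ := exists_cmRow_of_mod_three_eq_two p hp5 h3'
    exact ⟨V, ‹_›, ‹_›, hg, ha, hn, hc⟩

/-! ## §5 The extremes: `p = 15073` (no CM row; the crux vacuous under uniformity) and `p = 3167` (every CM class a row) -/

/-- `15073` is prime (for consumers: `haveI : Fact (Nat.Prime 15073) := ⟨prime_15073⟩`). [folklore] -/
theorem prime_15073 : Nat.Prime 15073 := by norm_num

/-- `3167` is prime. [folklore] -/
theorem prime_3167 : Nat.Prime 3167 := by norm_num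

/-- **At `p = 15073` NO CM curve is a row of crux 19606**: `15073` is the least prime split in all nine imaginary quadratic fields of
class number one (`(d | 15073) = +1` for `d = −3, −4, −7, −8, −11, −19, −43, −67, −163`; Jacobi symbols by `norm_num`), so by §1 no
globally minimal CM curve good at `15073` has `a_p = 0` with non-onto tower (indeed every CM curve is ORDINARY there). Minimality of
`15073` is a search fact recorded in the seat memo, not used. [cite: Cox2013, Cor. 5.17] [cite: SilvermanAdvancedTopics1994, App. A §3] -/
theorem not_cmRow_fifteen073 [Fact (Nat.Prime 15073)] (V : WeierstrassCurve ℚ) [V.IsElliptic] [V.IsGloballyMinimal]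
    (hgood : V.HasGoodReductionAtPrime 15073) (hCM : V.HasCM) :
    ¬ (V.frobeniusTrace 15073 = 0 ∧ ¬ ∀ m : ℕ, V.HasSurjectiveModNGaloisRep ((15073 : ℕ) ^ m : ℕ)) := by
  rw [cmRow_iff_legendreSym_eq_neg_one V 15073 (by norm_num) hgood hCM]
  have hj := (hasCM_iff_j_mem_holds V).mp hCM
  simp only [cmJInvariants, Finset.mem_insert, Finset.mem_singleton] at hj
  rcases hj with h | h | h | h | h | h | h | h | h | h | h | h | h <;>
    · rw [h]; norm_num [cmFieldDiscrOfJ]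

/-- **Under Serre's uniformity question (`SerreUniformityBound 37`, OPEN — displayed hypothesis) crux 19606 is VACUOUSLY TRUE at
`p = 15073`**: a row there is non-CM (§5, no CM rows), hence `ρ̄_{V,15073}` is onto (uniformity, `15073 > 37`) and so is
the whole tower (Serre's lifting lemma `serre_hasSurjectiveModNGaloisRep_pow_holds`) — contradiction; so (C1⁺_η) holds at `(V, 15073)` for every row `V`, with NO CM input, NO transfer binder, NO analytic `μ`. The same
argument applies at every prime `> 37` split or ramified in all nine class-number-one fields (density `2⁻⁹` among primes; `15073,
18313, 38833, 69337, …`). [cite: SerreKyoto1977, question 6.5, p. 187] [cite: FurioLombardo2023, §1 (Question 1.1, bound 37)] -/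
theorem quadraticBranchPlusEtaAt_fifteen073_of_serreUniformityBound (hS : SerreUniformityBound 37) [Fact (Nat.Prime 15073)]
    (V : WeierstrassCurve ℚ) [V.IsElliptic] [V.IsGloballyMinimal] (hgood : V.HasGoodReductionAtPrime 15073)
    (hap : V.frobeniusTrace 15073 = 0) (hns : ¬ ∀ m : ℕ, V.HasSurjectiveModNGaloisRep ((15073 : ℕ) ^ m : ℕ)) :
    QuadraticBranchPlusEtaMainConjectureAt V 15073 := by
  by_cases hCM : V.HasCM
  · exact absurd ⟨hap, hns⟩ (not_cmRow_fifteen073 V hgood hCM)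
  · exact absurd (serre_hasSurjectiveModNGaloisRep_pow_holds V 15073 (by norm_num) (hS V hCM 15073 Fact.out (by norm_num))) hns

/-- **A general form of the vacuity**: at any prime `p > 37` at which NO CM curve has `p` inert in its CM field, `SerreUniformityBound 37`
alone gives (C1⁺_η) at every row (there is none). [cite: SerreKyoto1977, question 6.5] [cite: Cox2013, Cor. 5.17] -/
theorem quadraticBranchPlusEtaAt_of_serreUniformityBound_of_forall_not_cmInert (hS : SerreUniformityBound 37) (p : ℕ) [Fact p.Prime]
    (hp37 : 37 < p) (hsplit : ∀ (A : WeierstrassCurve ℚ) [A.IsElliptic], A.HasCM → ¬ CMInert A p)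
    (V : WeierstrassCurve ℚ) [V.IsElliptic] [V.IsGloballyMinimal] (hgood : V.HasGoodReductionAtPrime p)
    (hap : V.frobeniusTrace p = 0) (hns : ¬ ∀ m : ℕ, V.HasSurjectiveModNGaloisRep (p ^ m : ℕ)) :
    QuadraticBranchPlusEtaMainConjectureAt V p := by
  by_cases hCM : V.HasCM
  · exact absurd ((cmRow_iff_cmInert V p (by omega) hgood hCM).mp ⟨hap, hns⟩) (hsplit V hCM)
  · exact absurd (serre_hasSurjectiveModNGaloisRep_pow_holds V p (by omega) (hS V hCM p Fact.out hp37)) hns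

/-- **At `p = 3167` EVERY globally minimal CM curve good at `p` is a row of crux 19606**: `3167` is the least prime INERT in all nine
imaginary quadratic fields of class number one (`(d | 3167) = −1` for the nine `d`; Jacobi symbols by `norm_num`), so all thirteen CM
`j`-classes occur as rows there (§1; every CM curve is SUPERSINGULAR at `3167`). [cite: Cox2013, Cor. 5.17] [cite: Lang1987, Ch. 13 §4 Thm. 12] -/
theorem cmRow_3167_of_hasCM [Fact (Nat.Prime 3167)] (V : WeierstrassCurve ℚ) [V.IsElliptic] [V.IsGloballyMinimal]
    (hgood : V.HasGoodReductionAtPrime 3167) (hCM : V.HasCM) :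
    V.frobeniusTrace 3167 = 0 ∧ ¬ ∀ m : ℕ, V.HasSurjectiveModNGaloisRep ((3167 : ℕ) ^ m : ℕ) := by
  rw [cmRow_iff_legendreSym_eq_neg_one V 3167 (by norm_num) hgood hCM]
  have hj := (hasCM_iff_j_mem_holds V).mp hCM
  simp only [cmJInvariants, Finset.mem_insert, Finset.mem_singleton] at hj
  rcases hj with h | h | h | h | h | h | h | h | h | h | h | h | h <;>
    · rw [h]; norm_num [cmFieldDiscrOfJ]

end Summit.BirchSwinnertonDyer.BirchSwinnertonDyer.Theorems.EtaCartanField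

end
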